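import Literature.Geometry.Lorentzian.DevelopmentGluingData
import Literature.Geometry.Lorentzian.GluedTimeOrientation
import HarnessLib

/-!
# Gluing two globally hyperbolic developments along a common development: the Lorentzian metric
# and the time orientation of the glued space (Sbierski 2016, §3.3, proof of Thm. 5)

Sequel to `DevelopmentGluingData` (the glued space `M̃ = (M ⊔ M')/∼` of a common development
`𝔠 = (U, ψ)` of two Cauchy developments `𝒟`, `𝒟'`, its Hausdorff criterion, second countability,
connectedness). Here: the two bullets

> *"`M̃` has a natural smooth Lorentzian metric …: Since `π ∘ j` and `π ∘ j'` are smooth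
> diffeomorphism onto their image, we can endow `M̃` with a smooth Lorentzian metric by pushing
> forward `g` and `g'`. On `(π ∘ j)(U)` the two metrics obtained in this way agree since `ψ` is
> an isometry … Moreover, note that this turns `π ∘ j` and `π ∘ j'` into isometries."*
>
> *"`(M̃, g̃)` has a natural time orientation: Since `M` and `M'` are time oriented, there exist
> continuous timelike vector fields `T` on `M` and `T'` on `M'`. Since `ψ : U → M'` preserves the
> time orientation, at each point `ψ_*(T|_U)` and `T'|_{ψ(U)}` lie in the same component of the set
> of all timelike tangent vectors at this point. Thus … we can consistently single out a future
> direction at each point of `M̃`. It remains to show that this choice is continuous. But since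
> this is a local property …"*

of J. Sbierski, Ann. Henri Poincaré 17 (2016) = arXiv:1309.7591v3, §3.3, proof of Thm. 5.

* `CommonDevelopment.gluedMetric` — the Lorentzian metric `g̃` on `𝔠.Glued` with
  `inl^* g̃ = g`, `inr^* g̃ = g'` (`val_gluedMetric_inl`, `val_gluedMetric_inr`): the
  pseudo-Riemannian metric is `SmoothGlueData.exists_metric_of_glue_isometry` (`GluedMetric.lean`:
  push forward along the open embeddings, glue by the sheaf property of tensor fields), fed with
  the isometry identity of `ψ` (`glue_isometry`); the Lorentzian signature conditions transfer
  through the bijective isometric differentials of `inl`, `inr`;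
* `isIsometricImmersion_inl`, `isIsometricImmersion_inr` — `π ∘ j`, `π ∘ j'` are isometric
  immersions;
* `val_inlField_inrField_neg` — **the two pushed-forward orienting fields lie in the same
  timecone** on the overlap (`ψ` preserves the time orientation);
* `exists_timeOrientation` / `gluedTimeOrientation` — **a time orientation of `(M̃, g̃)` for which
  `π ∘ j` and `π ∘ j'` preserve the time orientation** (`preservesTimeOrientation_inl`,
  `preservesTimeOrientation_inr`), for Hausdorff `M̃` (no corresponding boundary points). The
  tree's time orientations are smooth timelike vector fields (O'Neill 1983, Ch. 5, Lemma 5.32: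
  equivalent to a continuous choice of timecones), so the "consistent choice of a future
  direction" is realised by a smooth timelike field: the future timecones of the pushed-forward
  fields form a convex-valued family admitting smooth local sections (the pushed-forward fields
  themselves, `contMDiffOn_inlField`), hence a smooth global section by a partition of unity
  (Mathlib's `exists_contMDiffSection_forall_mem_convex_of_local`; the glued space is σ-compact
  as a second countable finite-dimensional manifold).

Supporting: `OpenSubmanifold.contMDiffAt_tangentSection_of_restrict` (a vector field whose
restriction to an open submanifold is smooth is smooth there — converse of the tree's
`OpenSubmanifold.contMDiff_tangentSection`). No named facts are introduced (D-0026);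
`gluedMetric`, `inlField`, `inrField`, `refField`, `gluedTimeOrientation` are definitions with
bodies, everything else is proved.

## References

* J. Sbierski, Ann. Henri Poincaré 17 (2016) 301–329 = arXiv:1309.7591v3, §3.3, proof of
  Thm. 5 (p. 18 of the arXiv version).
* B. O'Neill, *Semi-Riemannian geometry with applications to relativity*, 1983, Ch. 3,
  pp. 90–91 (local isometries), Ch. 5, Lemma 5.26–5.32 and p. 145 (timecones, time
  orientability).
* Y. Choquet-Bruhat, R. Geroch, Comm. Math. Phys. 14 (1969) 329–335, proof of Thm. 3, p. 334.
-/

noncomputable section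

open Bundle Set Function Filter TopologicalSpace Topology Manifold VectorField
open scoped Manifold ContDiff Topology
open Literature.Topology.FourManifolds

namespace Literature.Geometry.Lorentzian

universe u

/-! ### The glued metric -/

section Developments

variable {n : ℕ} {X : Type u} [TopologicalSpace X] [ChartedSpace (EuclideanSpace ℝ (Fin n)) X]
  [IsManifold (𝓡 n) ∞ X] [ConnectedSpace X] {D : InitialDataSet (𝓡 n) X}

namespace CauchyDevelopment

namespace CommonDevelopment

variable {𝒟 𝒟' : CauchyDevelopment D} (𝔠 : CommonDevelopment 𝒟 𝒟')

/-- **The gluing map is an isometry** in the form required by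
`SmoothGlueData.exists_metric_of_glue_isometry`: `g'(dψ v, dψ w) = g(v, w)` on `U`.
[cite: Sbierski2016AHP, §3.3, proof of Thm. 5 ("the two metrics … agree since `ψ` is an isometry")] -/
theorem glue_isometry (a : 𝒟.carrier) (ha : a ∈ 𝔠.glueData.glue.source)
    (v w : TangentSpace (𝓡 (n + 1)) a) :
    𝒟'.metric.toPseudoRiemannianMetric.val (𝔠.glueData.glue a)
        (mfderiv (𝓡 (n + 1)) (𝓡 (n + 1)) 𝔠.glueData.glue a v)
        (mfderiv (𝓡 (n + 1)) (𝓡 (n + 1)) 𝔠.glueData.glue a w) =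
      𝒟.metric.toPseudoRiemannianMetric.val a v w := by
  have ha' : a ∈ 𝔠.opens := by
    have h := ha
    rw [glueData_glue, glue_source] at h
    exact h
  have hd : mfderiv (𝓡 (n + 1)) (𝓡 (n + 1)) 𝔠.glueData.glue a =
      mfderiv (𝓡 (n + 1)) (𝓡 (n + 1)) 𝔠.map ⟨a, ha'⟩ := 𝔠.mfderiv_glue_eq ⟨a, ha'⟩
  have hp : 𝔠.glueData.glue a = 𝔠.map ⟨a, ha'⟩ := 𝔠.glue_apply ha'
  have h := congrArg (fun b ↦ b v w) (𝔠.isIsometricImmersion.2 ⟨a, ha'⟩)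
  simp only [pullbackBilin_apply] at h
  rw [hd]
  have hgen : ∀ p, p = 𝔠.map ⟨a, ha'⟩ →
      𝒟'.metric.toPseudoRiemannianMetric.val p
        (mfderiv (𝓡 (n + 1)) (𝓡 (n + 1)) 𝔠.map ⟨a, ha'⟩ v)
        (mfderiv (𝓡 (n + 1)) (𝓡 (n + 1)) 𝔠.map ⟨a, ha'⟩ w) =
      𝒟.metric.toPseudoRiemannianMetric.val a v w := by
    rintro p rfl
    exact h
  exact hgen _ hp

/-- The pseudo-Riemannian metric of the glued space (a choice of the metric of
`SmoothGlueData.exists_metric_of_glue_isometry`). [cite: Sbierski2016AHP, §3.3, proof of Thm. 5 ("pushing forward `g` and `g'`")] -/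
def gluedPseudoMetric : PseudoRiemannianMetric 𝓘(ℝ, EuclideanSpace ℝ (Fin (n + 1))) ∞
    (EuclideanSpace ℝ (Fin (n + 1)))
    (TangentSpace 𝓘(ℝ, EuclideanSpace ℝ (Fin (n + 1))) : 𝔠.Glued → Type _) :=
  Classical.choose (𝔠.glueData.exists_metric_of_glue_isometry 𝒟.metric.toPseudoRiemannianMetric
    𝒟'.metric.toPseudoRiemannianMetric 𝔠.glue_isometry)

/-- `inl^* g̃ = g` for the glued pseudo-Riemannian metric. [cite: Sbierski2016AHP, §3.3, proof of Thm. 5] -/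
theorem val_gluedPseudoMetric_inl (a : 𝒟.carrier) (v w : TangentSpace (𝓡 (n + 1)) a) :
    𝔠.gluedPseudoMetric.val (𝔠.inl a) (mfderiv (𝓡 (n + 1)) (𝓡 (n + 1)) 𝔠.inl a v)
      (mfderiv (𝓡 (n + 1)) (𝓡 (n + 1)) 𝔠.inl a w) = 𝒟.metric.val a v w :=
  (Classical.choose_spec (𝔠.glueData.exists_metric_of_glue_isometry
    𝒟.metric.toPseudoRiemannianMetric 𝒟'.metric.toPseudoRiemannianMetric 𝔠.glue_isometry)).1 a v w

/-- `inr^* g̃ = g'` for the glued pseudo-Riemannian metric. [cite: Sbierski2016AHP, §3.3, proof of Thm. 5] -/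
theorem val_gluedPseudoMetric_inr (b : 𝒟'.carrier) (v w : TangentSpace (𝓡 (n + 1)) b) :
    𝔠.gluedPseudoMetric.val (𝔠.inr b) (mfderiv (𝓡 (n + 1)) (𝓡 (n + 1)) 𝔠.inr b v)
      (mfderiv (𝓡 (n + 1)) (𝓡 (n + 1)) 𝔠.inr b w) = 𝒟'.metric.val b v w :=
  (Classical.choose_spec (𝔠.glueData.exists_metric_of_glue_isometry
    𝒟.metric.toPseudoRiemannianMetric 𝒟'.metric.toPseudoRiemannianMetric 𝔠.glue_isometry)).2 b v w

/-- The differential of `inl` is bijective. [folklore] -/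
theorem mfderiv_inl_bijective (a : 𝒟.carrier) :
    Bijective (mfderiv (𝓡 (n + 1)) (𝓡 (n + 1)) 𝔠.inl a) :=
  𝔠.glueData.mfderiv_inl_bijective a

/-- The differential of `inr` is bijective. [folklore] -/
theorem mfderiv_inr_bijective (b : 𝒟'.carrier) :
    Bijective (mfderiv (𝓡 (n + 1)) (𝓡 (n + 1)) 𝔠.inr b) :=
  𝔠.glueData.mfderiv_inr_bijective b

/-- **The glued Lorentzian metric `g̃`** on `M̃` (Sbierski 2016, §3.3: *"we can endow `M̃` with a
smooth Lorentzian metric by pushing forward `g` and `g'`"*): the glued pseudo-Riemannian metric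
has Lorentzian signature, every tangent space of `M̃` being isometric to one of `M` or of `M'`
through the bijective differential of `inl` or `inr`. [cite: Sbierski2016AHP, §3.3, proof of Thm. 5 ("`M̃` has a natural smooth Lorentzian metric")] -/
def gluedMetric : LorentzianMetric (𝓡 (n + 1)) ∞ 𝔠.Glued where
  toPseudoRiemannianMetric := 𝔠.gluedPseudoMetric
  exists_timelike p := by
    obtain (⟨a, rfl⟩ | ⟨b, rfl⟩) := 𝔠.glueData.exists_inl_or_inr p
    · obtain ⟨v, hv⟩ := 𝒟.metric.exists_timelike a
      exact ⟨mfderiv (𝓡 (n + 1)) (𝓡 (n + 1)) 𝔠.inl a v, by rw [𝔠.val_gluedPseudoMetric_inl]; exact hv⟩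
    · obtain ⟨v, hv⟩ := 𝒟'.metric.exists_timelike b
      exact ⟨mfderiv (𝓡 (n + 1)) (𝓡 (n + 1)) 𝔠.inr b v, by rw [𝔠.val_gluedPseudoMetric_inr]; exact hv⟩
  pos_of_orthogonal p V W hV hVW hW := by
    obtain (⟨a, rfl⟩ | ⟨b, rfl⟩) := 𝔠.glueData.exists_inl_or_inr p
    · obtain ⟨v, rfl⟩ := (𝔠.mfderiv_inl_bijective a).2 V
      obtain ⟨w, rfl⟩ := (𝔠.mfderiv_inl_bijective a).2 W
      have hw : w ≠ 0 := fun h ↦ hW (by rw [h, map_zero])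
      rw [𝔠.val_gluedPseudoMetric_inl] at hV hVW ⊢
      exact 𝒟.metric.pos_of_orthogonal a v w hV hVW hw
    · obtain ⟨v, rfl⟩ := (𝔠.mfderiv_inr_bijective b).2 V
      obtain ⟨w, rfl⟩ := (𝔠.mfderiv_inr_bijective b).2 W
      have hw : w ≠ 0 := fun h ↦ hW (by rw [h, map_zero])
      rw [𝔠.val_gluedPseudoMetric_inr] at hV hVW ⊢
      exact 𝒟'.metric.pos_of_orthogonal b v w hV hVW hw

/-- `g̃(d(inl) v, d(inl) w) = g(v, w)`. [cite: Sbierski2016AHP, §3.3, proof of Thm. 5 ("this turns `π ∘ j` … into isometries")] -/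
theorem val_gluedMetric_inl (a : 𝒟.carrier) (v w : TangentSpace (𝓡 (n + 1)) a) :
    𝔠.gluedMetric.val (𝔠.inl a) (mfderiv (𝓡 (n + 1)) (𝓡 (n + 1)) 𝔠.inl a v)
      (mfderiv (𝓡 (n + 1)) (𝓡 (n + 1)) 𝔠.inl a w) = 𝒟.metric.val a v w :=
  𝔠.val_gluedPseudoMetric_inl a v w

/-- `g̃(d(inr) v, d(inr) w) = g'(v, w)`. [cite: Sbierski2016AHP, §3.3, proof of Thm. 5 ("this turns … `π ∘ j'` into isometries")] -/
theorem val_gluedMetric_inr (b : 𝒟'.carrier) (v w : TangentSpace (𝓡 (n + 1)) b) :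
    𝔠.gluedMetric.val (𝔠.inr b) (mfderiv (𝓡 (n + 1)) (𝓡 (n + 1)) 𝔠.inr b v)
      (mfderiv (𝓡 (n + 1)) (𝓡 (n + 1)) 𝔠.inr b w) = 𝒟'.metric.val b v w :=
  𝔠.val_gluedPseudoMetric_inr b v w

/-- **`π ∘ j : M → M̃` is an isometric immersion.** [cite: Sbierski2016AHP, §3.3, proof of Thm. 5 ("this turns `π ∘ j` and `π ∘ j'` into isometries")] -/
theorem isIsometricImmersion_inl :
    𝒟.metric.IsIsometricImmersion 𝔠.gluedMetric.toPseudoRiemannianMetric 𝔠.inl :=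
  ⟨𝔠.glueData.contMDiff_inl, fun a ↦ by
    ext v w
    rw [pullbackBilin_apply]
    exact 𝔠.val_gluedMetric_inl a v w⟩

/-- **`π ∘ j' : M' → M̃` is an isometric immersion.** [cite: Sbierski2016AHP, §3.3, proof of Thm. 5 ("this turns `π ∘ j` and `π ∘ j'` into isometries")] -/
theorem isIsometricImmersion_inr :
    𝒟'.metric.IsIsometricImmersion 𝔠.gluedMetric.toPseudoRiemannianMetric 𝔠.inr :=
  ⟨𝔠.glueData.contMDiff_inr, fun b ↦ by
    ext v w
    rw [pullbackBilin_apply]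
    exact 𝔠.val_gluedMetric_inr b v w⟩

/-! ### The pushed-forward orienting fields lie in one timecone -/

/-- The orienting field of `M` pushed forward to `M̃` at `π j a`. [cite: Sbierski2016AHP, §3.3, proof of Thm. 5 ("pushing forward `T` … via `π ∘ j`")] -/
def inlVec (a : 𝒟.carrier) : EuclideanSpace ℝ (Fin (n + 1)) :=
  mfderiv (𝓡 (n + 1)) (𝓡 (n + 1)) 𝔠.inl a (𝒟.timeOrientation.vectorField a)

/-- The orienting field of `M'` pushed forward to `M̃` at `π j' b`. [cite: Sbierski2016AHP, §3.3, proof of Thm. 5 ("pushing forward … `T'` via … `π ∘ j'`")] -/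
def inrVec (b : 𝒟'.carrier) : EuclideanSpace ℝ (Fin (n + 1)) :=
  mfderiv (𝓡 (n + 1)) (𝓡 (n + 1)) 𝔠.inr b (𝒟'.timeOrientation.vectorField b)

/-- The pushed-forward orienting vector of `M` is timelike for `g̃`. [folklore] -/
theorem isTimelike_inlVec (a : 𝒟.carrier) :
    𝔠.gluedMetric.IsTimelike (x := 𝔠.inl a) (𝔠.inlVec a) := by
  change 𝔠.gluedMetric.val (𝔠.inl a) (𝔠.inlVec a) (𝔠.inlVec a) < 0
  rw [inlVec, 𝔠.val_gluedMetric_inl]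
  exact 𝒟.timeOrientation.isTimelike a

/-- The pushed-forward orienting vector of `M'` is timelike for `g̃`. [folklore] -/
theorem isTimelike_inrVec (b : 𝒟'.carrier) :
    𝔠.gluedMetric.IsTimelike (x := 𝔠.inr b) (𝔠.inrVec b) := by
  change 𝔠.gluedMetric.val (𝔠.inr b) (𝔠.inrVec b) (𝔠.inrVec b) < 0
  rw [inrVec, 𝔠.val_gluedMetric_inr]
  exact 𝒟'.timeOrientation.isTimelike b

/-- **The pushed-forward orienting fields of `M` and `M'` lie in the same timecone on the
overlap**: `g̃(d(π j) T_a, d(π j') T'_{ψ a}) < 0` for `a ∈ U` — `d(π j) T_a = d(π j') (dψ T_a)`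
(`inr ∘ ψ = inl` near `a`), `π j'` is an isometry, and `dψ T_a` is future-directed for `τ'`
because `ψ` preserves the time orientation. *"Since `ψ : U → M'` preserves the time orientation,
at each point `ψ_*(T|_U)` and `T'|_{ψ(U)}` lie in the same component of the set of all timelike
tangent vectors"* (Sbierski 2016, §3.3). [cite: Sbierski2016AHP, §3.3, proof of Thm. 5 (time orientation step)] -/
theorem val_inlVec_inrVec_neg (y : 𝔠.opens) :
    𝔠.gluedMetric.val (𝔠.inr (𝔠.map y)) (𝔠.inlVec y.1) (𝔠.inrVec (𝔠.map y)) < 0 := by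
  have hy : (y : 𝒟.carrier) ∈ 𝔠.glueData.glue.source := by
    rw [glueData_glue, glue_source]; exact y.2
  have h1 : 𝔠.inlVec y.1 = mfderiv (𝓡 (n + 1)) (𝓡 (n + 1)) 𝔠.inr (𝔠.map y)
      (mfderiv (𝓡 (n + 1)) (𝓡 (n + 1)) 𝔠.map y (𝒟.timeOrientation.vectorField y.1)) := by
    rw [inlVec]
    have h := 𝔠.glueData.mfderiv_inl_eq_mfderiv_inr_glue hy (𝒟.timeOrientation.vectorField y.1)
    rw [glueData_glue] at h
    rw [show 𝔠.inl = 𝔠.glueData.inl from rfl, h, 𝔠.mfderiv_glue_eq y]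
    -- transport of the base point `glue y = ψ y` of `d(inr)`
    have hp : 𝔠.glue y.1 = 𝔠.map y := 𝔠.glue_apply y.2
    have hgen : ∀ (b : 𝒟'.carrier), b = 𝔠.map y → ∀ (v : EuclideanSpace ℝ (Fin (n + 1))),
        mfderiv (𝓡 (n + 1)) (𝓡 (n + 1)) 𝔠.glueData.inr b v =
          mfderiv (𝓡 (n + 1)) (𝓡 (n + 1)) 𝔠.inr (𝔠.map y) v := by
      rintro b rfl v
      rfl
    exact hgen _ hp _
  rw [h1, inrVec, 𝔠.val_gluedMetric_inr, 𝒟'.metric.symm]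
  exact (𝔠.preservesTimeOrientation y).2


/-! ### The time orientation of the glued space and the glued spacetime -/

/-- **The cone compatibility in the form of `SmoothGlueData.exists_timeOrientation_of_glue`**:
on the gluing region `U`, `g̃(d(π j) T_a, d(π j') T'_{ψ a}) < 0` (`val_inlVec_inrVec_neg`,
transported to the base point `π j a = π j' (ψ a)`). [cite: Sbierski2016AHP, §3.3, proof of Thm. 5 (time orientation step)] -/
theorem cone_compat (a : 𝒟.carrier) (ha : a ∈ 𝔠.glueData.glue.source) :
    𝔠.gluedMetric.val (𝔠.glueData.inl a)
        (mfderiv (𝓡 (n + 1)) (𝓡 (n + 1)) 𝔠.glueData.inl a (𝒟.timeOrientation.vectorField a))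
        (mfderiv (𝓡 (n + 1)) (𝓡 (n + 1)) 𝔠.glueData.inr (𝔠.glueData.glue a)
          (𝒟'.timeOrientation.vectorField (𝔠.glueData.glue a))) < 0 := by
  have ha' : a ∈ 𝔠.opens := by
    have h := ha
    rw [glueData_glue, glue_source] at h
    exact h
  have h := 𝔠.val_inlVec_inrVec_neg ⟨a, ha'⟩
  have hp : 𝔠.glueData.glue a = 𝔠.map ⟨a, ha'⟩ := 𝔠.glue_apply ha'
  have hq : 𝔠.inr (𝔠.map ⟨a, ha'⟩) = 𝔠.inl a := 𝔠.inr_map ⟨a, ha'⟩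
  have hgen : ∀ b : 𝒟'.carrier, b = 𝔠.map ⟨a, ha'⟩ → ∀ p : 𝔠.Glued, p = 𝔠.inr (𝔠.map ⟨a, ha'⟩) →
      𝔠.gluedMetric.val p (𝔠.inlVec a)
        (mfderiv (𝓡 (n + 1)) (𝓡 (n + 1)) 𝔠.inr b (𝒟'.timeOrientation.vectorField b)) < 0 := by
    rintro b rfl p rfl
    exact h
  exact hgen _ hp _ hq.symm

/-- **A time orientation of `(M̃, g̃)` making `π j`, `π j'` time-orientation preserving exists when
`M̃` is Hausdorff** (`SmoothGlueData.exists_timeOrientation_of_glue` with the cone compatibility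
`cone_compat`). [cite: Sbierski2016AHP, §3.3, proof of Thm. 5 ("`(M̃, g̃)` has a natural time orientation")] -/
theorem exists_timeOrientation [T2Space 𝔠.Glued] :
    ∃ τ : TimeOrientation 𝔠.gluedMetric,
      (∀ a, τ.IsFutureDirected (x := 𝔠.inl a) (𝔠.inlVec a)) ∧
        ∀ b, τ.IsFutureDirected (x := 𝔠.inr b) (𝔠.inrVec b) :=
  𝔠.glueData.exists_timeOrientation_of_glue 𝒟.timeOrientation 𝒟'.timeOrientation 𝔠.gluedMetric
    𝔠.val_gluedMetric_inl 𝔠.val_gluedMetric_inr 𝔠.cone_compat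

/-- **The glued time orientation** `T̃` of `(M̃, g̃)`, for a common development without
corresponding boundary points (so that `M̃` is Hausdorff, `t2Space_glued`).
[cite: Sbierski2016AHP, §3.3, proof of Thm. 5 ("`(M̃, g̃)` has a natural time orientation")] -/
def gluedTimeOrientation (h : ¬ 𝔠.HasCorrespondingBoundaryPoints) : TimeOrientation 𝔠.gluedMetric :=
  haveI := 𝔠.t2Space_glued h
  Classical.choose 𝔠.exists_timeOrientation

/-- **`π j : M → M̃` preserves the time orientations.** [cite: Sbierski2016AHP, §3.3, proof of Thm. 5 (time orientation step)] -/
theorem preservesTimeOrientation_inl (h : ¬ 𝔠.HasCorrespondingBoundaryPoints) :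
    𝒟.timeOrientation.PreservesTimeOrientation 𝔠.inl (𝔠.gluedTimeOrientation h) := by
  haveI := 𝔠.t2Space_glued h
  exact fun a ↦ (Classical.choose_spec 𝔠.exists_timeOrientation).1 a

/-- **`π j' : M' → M̃` preserves the time orientations.** [cite: Sbierski2016AHP, §3.3, proof of Thm. 5 (time orientation step)] -/
theorem preservesTimeOrientation_inr (h : ¬ 𝔠.HasCorrespondingBoundaryPoints) :
    𝒟'.timeOrientation.PreservesTimeOrientation 𝔠.inr (𝔠.gluedTimeOrientation h) := by
  haveI := 𝔠.t2Space_glued h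
  exact fun b ↦ (Classical.choose_spec 𝔠.exists_timeOrientation).2 b

/-- **The glued spacetime** `(M̃, g̃, T̃)`: connected, Hausdorff (no corresponding boundary
points), second countable, smooth `(n+1)`-manifold with the glued Lorentzian metric and time
orientation. Reducible, so that its instance projections reduce to the instances of `𝔠.Glued`
during unification. [cite: Sbierski2016AHP, §3.3, proof of Thm. 5] -/
@[reducible]
def gluedSpacetime (h : ¬ 𝔠.HasCorrespondingBoundaryPoints) : Spacetime.{u} (n + 1) where
  carrier := 𝔠.Glued
  t2Space := 𝔠.t2Space_glued h
  metric := 𝔠.gluedMetric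
  timeOrientation := 𝔠.gluedTimeOrientation h

/-- The carrier of the glued spacetime is the glued space. [folklore] -/
@[simp]
theorem gluedSpacetime_carrier (h : ¬ 𝔠.HasCorrespondingBoundaryPoints) :
    (𝔠.gluedSpacetime h).carrier = 𝔠.Glued := rfl

/-- `π j` is a time-orientation preserving isometric immersion of `M` into the glued spacetime.
[cite: Sbierski2016AHP, §3.3, proof of Thm. 5 ("it is an extension of `M` and `M'`")] -/
theorem isIsometricImmersion_inl_gluedSpacetime (h : ¬ 𝔠.HasCorrespondingBoundaryPoints) :
    𝒟.metric.IsIsometricImmersion (𝔠.gluedSpacetime h).metric.toPseudoRiemannianMetric 𝔠.inl ∧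
      𝒟.timeOrientation.PreservesTimeOrientation 𝔠.inl (𝔠.gluedSpacetime h).timeOrientation :=
  ⟨𝔠.isIsometricImmersion_inl, 𝔠.preservesTimeOrientation_inl h⟩

/-- `π j'` is a time-orientation preserving isometric immersion of `M'` into the glued spacetime.
[cite: Sbierski2016AHP, §3.3, proof of Thm. 5 ("it is an extension of `M` and `M'`")] -/
theorem isIsometricImmersion_inr_gluedSpacetime (h : ¬ 𝔠.HasCorrespondingBoundaryPoints) :
    𝒟'.metric.IsIsometricImmersion (𝔠.gluedSpacetime h).metric.toPseudoRiemannianMetric 𝔠.inr ∧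
      𝒟'.timeOrientation.PreservesTimeOrientation 𝔠.inr (𝔠.gluedSpacetime h).timeOrientation :=
  ⟨𝔠.isIsometricImmersion_inr, 𝔠.preservesTimeOrientation_inr h⟩

end CommonDevelopment

end CauchyDevelopment

end Developments

end Literature.Geometry.Lorentzian

end
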